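import Literature.NumberTheory.LFunctions.Zhang2022.RepairSection18Forms
import Literature.NumberTheory.LFunctions.Zhang2022.RepairFormMatrix
import Literature.NumberTheory.LFunctions.Zhang2022.RepairBoxPrimitives
import Literature.NumberTheory.LFunctions.Zhang2022.Section18EpsilonIdentity

/-!
# Zhang (2022), repair rung F-S1R: closed forms of the §12/§18 integrals at generic `θ`, the
# derived-`e″` residual as a boundary-layer term, and the `QP`/`QMOf` bridge

Y. Zhang, *Discrete mean estimates and the Landau–Siegel zero*, arXiv:2211.02515v1 (2022)
[Zhang2022LandauSiegel] — an unrefereed manuscript under adjudication; nothing here is a claim about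
its Theorems 1–2. Fourth file of the repair rung (human ruling D-0077). After `RepairSection18Theta`
(definitions) and `RepairSection18Forms` (affine structure in `ῑ`), this file makes the whole §18 block
INTEGRAL-FREE at every parameter point with non-zero shift multipliers, by the fundamental theorem of
calculus with explicit antiderivatives (real frequencies `k`; the tree's `Section8ClosedForm` /
`AppendixB.integral_ffF_closed` / `Section18Certificate.bstar_eq` are the rational-frequency instances):

* antiderivatives `expPrim k`, `zExpPrim k`, `ffRPrim a k` of `e^{kπiz}`, `z e^{kπiz}`,
  `(1 + aπiz)e^{kπiz}` (`hasDerivAt_…`), interval integrals `integral_cexp_kpi`, `integral_z_cexp_kpi`,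
  `integral_ffR`, `integral_ffT`, and the bridge `integral_ffR_eq_expQuadIntR` to the real-frequency
  closed form `expQuadIntR` of `RepairBoxPrimitives` (two evaluations of one integral);
* closed forms `bstarT_closed` ((12.10)), `e1ppT_closed` (stated `e″`), `e1ppDT_closed` ((B.3) derived
  `e″`), `A3T_closed`, `A2T_closed` ((12.15) pieces; lower limits `L₆ = ν₁ + ν₃ − 1`, `L₇ = ν₁ + ν₂ − 1`),
  and `eR_eq_closed`: the Lemma 15.1 closed form IS the window average `(1/ν)∫₀^ν 𝔣𝔣_{j,μ}` (θ-generic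
  `AppendixB.e3j_eq_average`), whence `e3T_sub_A3T`, `e2T_sub_A2T`: `e_{3j}(θ) − A₃ⱼ(θ) =
  (1/ν₃)∫₀^{L₆} 𝔣𝔣_{j,3}` — the sliver between the window of (4.1)–(4.3) and the range of (12.15);
* `e1ppDT_eq_neg_bstarT`: `e″ᴰ_{1j}(θ) = −jπi·b*(θ)` for every `θ` with `k₁ ≠ 0` (θ-generic
  `AppendixB.e1ppD_eq`), the derived-`e″` objects `frakeppDT`, `identResidualDT`, `frakc3DT` with
  `frakc3DT_eq_add` and regression `identResidualDT_theta0 = identResidualD`,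
  `frakc3DT_theta0 = frakc3D`; and **`identResidualDT_eq_boundary`** — the manuscript's "theoretical
  interpretation" of `i(3𝔢″₁ + 3𝔢″₂ + 𝔢″₃) + e₁* = ε` as an exact identity at every `θ`:
  `identResidualᴰ(θ) = π b*(θ) Σ_j (3,6,3)_j (ῑ₃(e_{3j} − A₃ⱼ) + ῑ₄(e_{2j} − A₂ⱼ))(θ)`, a product of the
  second-order window `b* = O((ν₁ − cut₁)²)` and the slivers `O(L₆), O(L₇)` — so the reduced form's
  error is NOT uniformly `10⁻⁵` over a parameter region: it grows with `ν₁ − cut₁`, `L₆`, `L₇`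
  (θ-generic `Section18EpsilonIdentity.identResidualD_eq_boundary`);
* `QP_eq_QMOf`: the parametric matrix of `RepairSection18Forms` is `RepairFormMatrix.QMOf` (one matrix
  constructor for the rung; `QP` is a frozen alias).

Calculus and algebra only; no `Prop` facts, no statement about Theorems 1–2.
-/

noncomputable section

open Complex Real ComplexConjugate

namespace Literature.NumberTheory.LFunctions.Zhang2022

namespace Repair

/-! ### One matrix constructor -/

/-- The parametric matrix `QP` of `RepairSection18Forms` (with its free `(4,4)` entry at `c₂₂`, the only
value the bridges feed it: `c₄₄(θ) = c₂₂(θ)`, (9.4)) is `RepairFormMatrix.QMOf`. [cite: Zhang2022LandauSiegel, (2.32), (9.4)] -/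
theorem QP_eq_QMOf (c11 c12 c22 c33 c34 F20 F21 F30 F31 : ℂ) (m : ℚ) :
    QP c11 c12 c22 c33 c34 c22 F20 F21 F30 F31 m = QMOf c11 (conj c12) c12 c22 c33 c34 F20 F21 F30 F31 m := rfl

/-! ### Antiderivatives for a real frequency `k ≠ 0` -/

/-- `e^{kπiz}/(kπi)`, an antiderivative of `e^{kπiz}`. [cite: Zhang2022LandauSiegel, Appendix B (B.3)] -/
def expPrim (k : ℝ) (z : ℝ) : ℂ := cexp ((k : ℂ) * π * I * z) / ((k : ℂ) * π * I)

/-- `(z/(kπi) − 1/(kπi)²)e^{kπiz}`, an antiderivative of `z e^{kπiz}`. [cite: Zhang2022LandauSiegel, §12 (12.10)] -/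
def zExpPrim (k : ℝ) (z : ℝ) : ℂ :=
  ((z : ℂ) / ((k : ℂ) * π * I) - 1 / ((k : ℂ) * π * I) ^ 2) * cexp ((k : ℂ) * π * I * z)

/-- `((1 − a/k + aπiz)/(kπi)) e^{kπiz}`, an antiderivative of `ffR a k z = (1 + aπiz)e^{kπiz}`.
[cite: Zhang2022LandauSiegel, §8 (8.13)–(8.18)] -/
def ffRPrim (a k : ℝ) (z : ℝ) : ℂ :=
  (1 - (a : ℂ) / k + (a : ℂ) * π * I * z) / ((k : ℂ) * π * I) * cexp ((k : ℂ) * π * I * z)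

/-- `d/dx (x : ℂ) = 1` (plumbing). [folklore] -/
private theorem hasDerivAt_ofReal' (z : ℝ) : HasDerivAt (fun x : ℝ => (x : ℂ)) 1 z := by
  simpa using (hasDerivAt_id z).ofReal_comp

/-- `d/dz e^{kπiz} = kπi e^{kπiz}` (plumbing). [folklore] -/
private theorem hasDerivAt_cexp_kpi (k z : ℝ) :
    HasDerivAt (fun x : ℝ => cexp ((k : ℂ) * π * I * x)) (cexp ((k : ℂ) * π * I * z) * ((k : ℂ) * π * I)) z :=
  (((hasDerivAt_ofReal' z).const_mul ((k : ℂ) * π * I)).cexp).congr_deriv (by ring)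

/-- `kπi ≠ 0` for `k ≠ 0` (plumbing). [folklore] -/
private theorem kpi_ne_zero {k : ℝ} (hk : k ≠ 0) : (k : ℂ) * π * I ≠ 0 := by
  have hk' : (k : ℂ) ≠ 0 := by exact_mod_cast hk
  have hπ : (π : ℂ) ≠ 0 := by exact_mod_cast Real.pi_ne_zero
  exact mul_ne_zero (mul_ne_zero hk' hπ) I_ne_zero

/-- `d/dz expPrim k z = e^{kπiz}` (`k ≠ 0`). [cite: Zhang2022LandauSiegel, Appendix B (B.3)] -/
theorem hasDerivAt_expPrim {k : ℝ} (hk : k ≠ 0) (z : ℝ) :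
    HasDerivAt (expPrim k) (cexp ((k : ℂ) * π * I * z)) z := by
  have hb := kpi_ne_zero hk
  have h := (hasDerivAt_cexp_kpi k z).div_const ((k : ℂ) * π * I)
  refine h.congr_deriv ?_
  rw [mul_div_assoc, div_self hb, mul_one]

/-- `d/dz zExpPrim k z = z e^{kπiz}` (`k ≠ 0`). [cite: Zhang2022LandauSiegel, §12 (12.10)] -/
theorem hasDerivAt_zExpPrim {k : ℝ} (hk : k ≠ 0) (z : ℝ) :
    HasDerivAt (zExpPrim k) ((z : ℂ) * cexp ((k : ℂ) * π * I * z)) z := by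
  have hb := kpi_ne_zero hk
  have hP : HasDerivAt (fun x : ℝ => (x : ℂ) / ((k : ℂ) * π * I) - 1 / ((k : ℂ) * π * I) ^ 2)
      (1 / ((k : ℂ) * π * I)) z := by
    simpa using ((hasDerivAt_ofReal' z).div_const ((k : ℂ) * π * I)).sub_const (1 / ((k : ℂ) * π * I) ^ 2)
  have h := hP.mul (hasDerivAt_cexp_kpi k z)
  refine h.congr_deriv ?_
  have hk' : (k : ℂ) ≠ 0 := by exact_mod_cast hk
  have hπ : (π : ℂ) ≠ 0 := by exact_mod_cast Real.pi_ne_zero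
  have hI : I ≠ 0 := I_ne_zero
  field_simp
  ring

/-- `d/dz ffRPrim a k z = ffR a k z` (`k ≠ 0`). [cite: Zhang2022LandauSiegel, §8 (8.13)–(8.18)] -/
theorem hasDerivAt_ffRPrim (a : ℝ) {k : ℝ} (hk : k ≠ 0) (z : ℝ) :
    HasDerivAt (ffRPrim a k) (ffR a k z) z := by
  have hb := kpi_ne_zero hk
  have hk' : (k : ℂ) ≠ 0 := by exact_mod_cast hk
  have hN : HasDerivAt (fun x : ℝ => (1 - (a : ℂ) / k + (a : ℂ) * π * I * x) / ((k : ℂ) * π * I))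
      ((a : ℂ) * π * I / ((k : ℂ) * π * I)) z := by
    have h1 := ((hasDerivAt_ofReal' z).const_mul ((a : ℂ) * π * I)).const_add (1 - (a : ℂ) / k)
    simpa using h1.div_const ((k : ℂ) * π * I)
  have h := hN.mul (hasDerivAt_cexp_kpi k z)
  refine h.congr_deriv ?_
  have hπ : (π : ℂ) ≠ 0 := by exact_mod_cast Real.pi_ne_zero
  have hI : I ≠ 0 := I_ne_zero
  unfold ffR
  field_simp
  ring

/-! ### Interval integrals -/

/-- `∫_{x₁}^{x₂} e^{kπiz} dz = expPrim k x₂ − expPrim k x₁`. [cite: Zhang2022LandauSiegel, Appendix B (B.3)] -/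
theorem integral_cexp_kpi {k : ℝ} (hk : k ≠ 0) (x1 x2 : ℝ) :
    ∫ z in x1..x2, cexp ((k : ℂ) * π * I * z) = expPrim k x2 - expPrim k x1 :=
  intervalIntegral.integral_eq_sub_of_hasDerivAt (fun z _ => hasDerivAt_expPrim hk z)
    (Continuous.intervalIntegrable (by fun_prop) _ _)

/-- `∫_{x₁}^{x₂} z e^{kπiz} dz = zExpPrim k x₂ − zExpPrim k x₁`. [cite: Zhang2022LandauSiegel, §12 (12.10)] -/
theorem integral_z_cexp_kpi {k : ℝ} (hk : k ≠ 0) (x1 x2 : ℝ) :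
    ∫ z in x1..x2, (z : ℂ) * cexp ((k : ℂ) * π * I * z) = zExpPrim k x2 - zExpPrim k x1 :=
  intervalIntegral.integral_eq_sub_of_hasDerivAt (fun z _ => hasDerivAt_zExpPrim hk z)
    (Continuous.intervalIntegrable (by fun_prop) _ _)

/-- The profiles `ffR a k` are continuous. [cite: Zhang2022LandauSiegel, §8 (8.13)–(8.18)] -/
theorem continuous_ffR (a k : ℝ) : Continuous (ffR a k) := by
  unfold ffR; fun_prop

/-- `∫_{x₁}^{x₂} ffR a k = ffRPrim a k x₂ − ffRPrim a k x₁`. [cite: Zhang2022LandauSiegel, §8 (8.13)–(8.18)] -/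
theorem integral_ffR (a : ℝ) {k : ℝ} (hk : k ≠ 0) (x1 x2 : ℝ) :
    ∫ z in x1..x2, ffR a k z = ffRPrim a k x2 - ffRPrim a k x1 :=
  intervalIntegral.integral_eq_sub_of_hasDerivAt (fun z _ => hasDerivAt_ffRPrim a hk z)
    ((continuous_ffR a k).intervalIntegrable _ _)

/-- `∫_{x₁}^{x₂} ffT k j = ffRPrim (k − j) k x₂ − ffRPrim (k − j) k x₁`. [cite: Zhang2022LandauSiegel, §8 (8.13)–(8.18)] -/
theorem integral_ffT {k : ℝ} (hk : k ≠ 0) (j : ℕ) (x1 x2 : ℝ) :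
    ∫ z in x1..x2, ffT k j z = ffRPrim (k - j) k x2 - ffRPrim (k - j) k x1 := by
  unfold ffT; exact integral_ffR _ hk x1 x2

/-- Bridge to `RepairBoxPrimitives.expQuadIntR` (two evaluations of `∫₀ᴸ (1 + aπiz)e^{kπiz}`).
[cite: Zhang2022LandauSiegel, §8 (8.13)–(8.18)] -/
theorem integral_ffR_eq_expQuadIntR (a : ℝ) {k : ℝ} (hk : k ≠ 0) (L : ℝ) :
    ffRPrim a k L - ffRPrim a k 0 = expQuadIntR 1 ((a : ℂ) * π * I) 0 k L := by
  rw [← integral_ffR a hk 0 L, ← integral_quad_mul_cexp_real 1 ((a : ℂ) * π * I) 0 hk L]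
  refine intervalIntegral.integral_congr (fun z _ => ?_)
  unfold ffR; ring

/-- Bridge: `zExpPrim k L − zExpPrim k 0 = expQuadIntR 0 1 0 k L`. [cite: Zhang2022LandauSiegel, §12 (12.10)] -/
theorem integral_z_cexp_eq_expQuadIntR {k : ℝ} (hk : k ≠ 0) (L : ℝ) :
    zExpPrim k L - zExpPrim k 0 = expQuadIntR 0 1 0 k L := by
  rw [← integral_z_cexp_kpi hk 0 L, ← integral_quad_mul_cexp_real 0 1 0 hk L]
  refine intervalIntegral.integral_congr (fun z _ => ?_)
  ring

/-! ### Closed forms of the §12/§18 integrals -/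

/-- (12.10) closed: `b*(θ) = (1/ν₁)(zExpPrim k₁ (ν₁ − cut₁) − zExpPrim k₁ 0)`, `k₁ ≠ 0`.
[cite: Zhang2022LandauSiegel, §12 (12.10)] -/
theorem bstarT_closed (θ : Theta) (hk : θ.k1 ≠ 0) :
    bstarT θ = ((1 / θ.nu1 : ℝ) : ℂ) * (zExpPrim θ.k1 θ.win - zExpPrim θ.k1 0) := by
  unfold bstarT; rw [integral_z_cexp_kpi hk]

/-- Lemma 15.1 stated `e″` closed:
`e″_{1j}(θ) = (j/(ν₁k₁))(expPrim k₁ ν₁ − expPrim k₁ cut₁ − (ν₁ − cut₁)e^{k₁cut₁πi})`, `k₁ ≠ 0`.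
[cite: Zhang2022LandauSiegel, Lemma 15.1] -/
theorem e1ppT_closed (θ : Theta) (hk : θ.k1 ≠ 0) (j : ℕ) :
    e1ppT θ j = (j : ℂ) / ((θ.nu1 * θ.k1 : ℝ) : ℂ) *
      (expPrim θ.k1 θ.nu1 - expPrim θ.k1 θ.cut1 - (θ.win : ℂ) * cexp ((θ.k1 * θ.cut1 : ℝ) * π * I)) := by
  unfold e1ppT
  congr 1
  have hc : Continuous fun z : ℝ => cexp ((θ.k1 : ℂ) * ((θ.nu1 : ℂ) - z) * π * I) := by fun_prop
  rw [intervalIntegral.integral_sub (hc.intervalIntegrable _ _) (Continuous.intervalIntegrable (by fun_prop) _ _),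
    intervalIntegral.integral_const]
  have e : (fun z : ℝ => cexp ((θ.k1 : ℂ) * ((θ.nu1 : ℂ) - z) * π * I))
      = fun z : ℝ => (fun u : ℝ => cexp ((θ.k1 : ℂ) * π * I * u)) (θ.nu1 - z) := by
    funext z; push_cast; ring_nf
  rw [e, intervalIntegral.integral_comp_sub_left (fun u : ℝ => cexp ((θ.k1 : ℂ) * π * I * u)) θ.nu1,
    integral_cexp_kpi hk]
  unfold Theta.win
  simp only [sub_zero, Complex.real_smul]
  push_cast
  ring

/-- (B.3) derived `e″` closed: `e″ᴰ_{1j}(θ) = (1/ν₁)(j/k₁)(expPrim k₁ (ν₁−cut₁) − expPrim k₁ 0 − (ν₁−cut₁)e^{k₁(ν₁−cut₁)πi})`,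
`k₁ ≠ 0`. [cite: Zhang2022LandauSiegel, Appendix B (B.3)] -/
theorem e1ppDT_closed (θ : Theta) (hk : θ.k1 ≠ 0) (j : ℕ) :
    e1ppDT θ j = ((1 / θ.nu1 : ℝ) : ℂ) * ((j : ℂ) / (θ.k1 : ℂ)) *
      (expPrim θ.k1 θ.win - expPrim θ.k1 0 - (θ.win : ℂ) * cexp ((θ.k1 * θ.win : ℝ) * π * I)) := by
  unfold e1ppDT
  congr 1
  have hc : Continuous fun z : ℝ => cexp ((θ.k1 : ℂ) * ((θ.nu1 : ℂ) - z) * π * I) := by fun_prop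
  rw [intervalIntegral.integral_sub (hc.intervalIntegrable _ _) (Continuous.intervalIntegrable (by fun_prop) _ _),
    intervalIntegral.integral_const]
  have e : (fun z : ℝ => cexp ((θ.k1 : ℂ) * ((θ.nu1 : ℂ) - z) * π * I))
      = fun z : ℝ => (fun u : ℝ => cexp ((θ.k1 : ℂ) * π * I * u)) (θ.nu1 - z) := by
    funext z; push_cast; ring_nf
  rw [e, intervalIntegral.integral_comp_sub_left (fun u : ℝ => cexp ((θ.k1 : ℂ) * π * I * u)) θ.nu1,
    integral_cexp_kpi hk, sub_self]
  unfold Theta.win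
  simp only [Complex.real_smul]

/-- (12.15) piece closed: `A₃ⱼ(θ) = (ffRPrim (k₃−j) k₃ ν₃ − ffRPrim (k₃−j) k₃ L₆)/ν₃`, `k₃ ≠ 0`
(the reflected window `[0, 1−ν₁]` becomes `[L₆, ν₃]`). [cite: Zhang2022LandauSiegel, §12 after (12.15)] -/
theorem A3T_closed (θ : Theta) (hk : θ.k3 ≠ 0) (j : ℕ) :
    A3T θ j = (ffRPrim (θ.k3 - j) θ.k3 θ.nu3 - ffRPrim (θ.k3 - j) θ.k3 θ.L6) / (θ.nu3 : ℂ) := by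
  unfold A3T
  rw [intervalIntegral.integral_div, intervalIntegral.integral_comp_sub_left (fun u : ℝ => ffT θ.k3 j u) θ.nu3,
    sub_zero, integral_ffT hk]
  have e : θ.nu3 - θ.nu1pp = θ.L6 := by unfold Theta.nu1pp Theta.L6; ring
  rw [e]

/-- (12.15) piece closed: `A₂ⱼ(θ) = (ffRPrim (k₂−j) k₂ ν₂ − ffRPrim (k₂−j) k₂ L₇)/ν₂`, `k₂ ≠ 0`.
[cite: Zhang2022LandauSiegel, §12 after (12.15)] -/
theorem A2T_closed (θ : Theta) (hk : θ.k2 ≠ 0) (j : ℕ) :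
    A2T θ j = (ffRPrim (θ.k2 - j) θ.k2 θ.nu2 - ffRPrim (θ.k2 - j) θ.k2 θ.L7) / (θ.nu2 : ℂ) := by
  unfold A2T
  rw [intervalIntegral.integral_div, intervalIntegral.integral_comp_sub_left (fun u : ℝ => ffT θ.k2 j u) θ.nu2,
    sub_zero, integral_ffT hk]
  have e : θ.nu2 - θ.nu1pp = θ.L7 := by unfold Theta.nu1pp Theta.L7; ring
  rw [e]

/-- **The Lemma 15.1 closed form is the window average**: for `ν, k ≠ 0`,
`e(ν, k; j) = (ffRPrim (k−j) k ν − ffRPrim (k−j) k 0)/ν = (1/ν)∫₀^ν 𝔣𝔣_{j,k}` (θ-generic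
`AppendixB.e3j_eq_average` / `e2j_eq_average` / `e1pj_eq_average`). [cite: Zhang2022LandauSiegel, Lemma 15.1, Appendix B] -/
theorem eR_eq_closed {ν k : ℝ} (hν : ν ≠ 0) (hk : k ≠ 0) (j : ℕ) :
    eR ν k j = (ffRPrim (k - j) k ν - ffRPrim (k - j) k 0) / (ν : ℂ) := by
  unfold eR ffRPrim
  have hk' : (k : ℂ) ≠ 0 := by exact_mod_cast hk
  have hν' : (ν : ℂ) ≠ 0 := by exact_mod_cast hν
  have hπ : (π : ℂ) ≠ 0 := by exact_mod_cast Real.pi_ne_zero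
  have hI : I ≠ 0 := I_ne_zero
  have e : cexp ((ν : ℂ) * k * π * I) = cexp ((k : ℂ) * π * I * ν) := by congr 1; ring
  rw [e]
  simp only [Complex.ofReal_zero, mul_zero, Complex.exp_zero, mul_one]
  push_cast
  field_simp
  ring

/-- `e(ν, k; j) = (1/ν)∫₀^ν ffT k j`, for `ν, k ≠ 0`. [cite: Zhang2022LandauSiegel, Lemma 15.1, Appendix B] -/
theorem eR_eq_average {ν k : ℝ} (hν : ν ≠ 0) (hk : k ≠ 0) (j : ℕ) :
    eR ν k j = (∫ z in (0:ℝ)..ν, ffT k j z) / (ν : ℂ) := by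
  rw [integral_ffT hk, eR_eq_closed hν hk]

/-- **The sliver**: `e_{3j}(θ) − A₃ⱼ(θ) = (1/ν₃)∫₀^{L₆} 𝔣𝔣_{j,3}` (`ν₃, k₃ ≠ 0`).
[cite: Zhang2022LandauSiegel, §12 after (12.15), Lemma 15.1] -/
theorem e3T_sub_A3T (θ : Theta) (hν : θ.nu3 ≠ 0) (hk : θ.k3 ≠ 0) (j : ℕ) :
    e3T θ j - A3T θ j = (∫ z in (0:ℝ)..θ.L6, ffT θ.k3 j z) / (θ.nu3 : ℂ) := by
  unfold e3T
  rw [eR_eq_closed hν hk, A3T_closed θ hk, integral_ffT hk]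
  have hν' : (θ.nu3 : ℂ) ≠ 0 := by exact_mod_cast hν
  rw [div_sub_div_same]
  congr 1
  ring

/-- **The sliver**: `e_{2j}(θ) − A₂ⱼ(θ) = (1/ν₂)∫₀^{L₇} 𝔣𝔣_{j,2}` (`ν₂, k₂ ≠ 0`).
[cite: Zhang2022LandauSiegel, §12 after (12.15), Lemma 15.1] -/
theorem e2T_sub_A2T (θ : Theta) (hν : θ.nu2 ≠ 0) (hk : θ.k2 ≠ 0) (j : ℕ) :
    e2T θ j - A2T θ j = (∫ z in (0:ℝ)..θ.L7, ffT θ.k2 j z) / (θ.nu2 : ℂ) := by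
  unfold e2T
  rw [eR_eq_closed hν hk, A2T_closed θ hk, integral_ffT hk]
  have hν' : (θ.nu2 : ℂ) ≠ 0 := by exact_mod_cast hν
  rw [div_sub_div_same]
  congr 1
  ring

/-! ### The derived `e″` at generic `θ`: `e″ᴰ_{1j} = −jπi b*`, and the residual as a boundary-layer term -/

/-- **`e″ᴰ_{1j}(θ) = −jπi·b*(θ)`** for every `θ` with `k₁ ≠ 0` (θ-generic `AppendixB.e1ppD_eq`).
[cite: Zhang2022LandauSiegel, Appendix B (B.3), §12 (12.10)] -/
theorem e1ppDT_eq_neg_bstarT (θ : Theta) (hk : θ.k1 ≠ 0) (j : ℕ) :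
    e1ppDT θ j = -((j : ℂ) * π * I) * bstarT θ := by
  rw [e1ppDT_closed θ hk, bstarT_closed θ hk]
  unfold expPrim zExpPrim
  have hk' : (θ.k1 : ℂ) ≠ 0 := by exact_mod_cast hk
  have hπ : (π : ℂ) ≠ 0 := by exact_mod_cast Real.pi_ne_zero
  have hI : I ≠ 0 := I_ne_zero
  have e : cexp (((θ.k1 * θ.win : ℝ) : ℂ) * π * I) = cexp ((θ.k1 : ℂ) * π * I * θ.win) := by
    congr 1; push_cast; ring
  rw [e]
  simp only [Complex.ofReal_zero, mul_zero, Complex.exp_zero, mul_one, zero_div, zero_sub]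
  push_cast
  field_simp
  ring

/-- `𝔢″_j` with the DERIVED `e″` at `θ` (tree: `frakeppD`). [cite: Zhang2022LandauSiegel, §18 before (18.2), Appendix B (B.3)] -/
def frakeppDT (θ : Theta) (j : ℕ) : ℂ := e1ppDT θ j * (conj θ.iota3 * e3T θ j + conj θ.iota4 * e2T θ j)

/-- `𝔢_j` with the DERIVED `e″` at `θ` (tree: `frakeD`). [cite: Zhang2022LandauSiegel, Lemma 15.1, Appendix B (B.3)] -/
def frakeDT (θ : Theta) (j : ℕ) : ℂ :=
  (e1pT θ j - e1ppDT θ j + θ.iota2 * e2T θ j) * (conj θ.iota3 * e3T θ j + conj θ.iota4 * e2T θ j)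

/-- the residual `i(3𝔢″₁ + 3𝔢″₂ + 𝔢″₃) + e₁*` with the DERIVED `e″` at `θ` (tree: `identResidualD`).
[cite: Zhang2022LandauSiegel, §18 before (18.2)] -/
def identResidualDT (θ : Theta) : ℂ := I * (3 * frakeppDT θ 1 + 3 * frakeppDT θ 2 + frakeppDT θ 3) + e1starT θ

/-- (18.1) with the DERIVED `e″` at `θ` (tree: `frakc3D`). [cite: Zhang2022LandauSiegel, §18 (18.1)] -/
def frakc3DT (θ : Theta) : ℂ :=
  -I * (3 * frakeDT θ 1 + 3 * frakeDT θ 2 + frakeDT θ 3 + frake0T θ) + e1starT θ + 2 * e2starT θ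

/-- `𝔠₃ᴰ(θ) = 𝔠₃ʳ(θ) + identResidualᴰ(θ)`. [cite: Zhang2022LandauSiegel, §18 before (18.2)] -/
theorem frakc3DT_eq_add (θ : Theta) : frakc3DT θ = frakc3rT θ + identResidualDT θ := by
  unfold frakc3DT frakc3rT identResidualDT frakeDT frakepT frakeppDT; ring

/-- regression: `𝔢″ᴰ_j(θ₀) = frakeppD j`. [cite: Zhang2022LandauSiegel, §18 before (18.2)] -/
theorem frakeppDT_theta0 (j : ℕ) : frakeppDT theta0 j = frakeppD j := by
  unfold frakeppDT frakeppD
  rw [e1ppDT_theta0, e3T_theta0, e2T_theta0, theta0_iota3, theta0_iota4]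

/-- regression: `identResidualᴰ(θ₀) = identResidualD`. [cite: Zhang2022LandauSiegel, §18 before (18.2)] -/
theorem identResidualDT_theta0 : identResidualDT theta0 = identResidualD := by
  unfold identResidualDT identResidualD
  rw [frakeppDT_theta0, frakeppDT_theta0, frakeppDT_theta0, e1starT_theta0]

/-- regression: `𝔠₃ᴰ(θ₀) = frakc3D`. [cite: Zhang2022LandauSiegel, §18 (18.1)] -/
theorem frakc3DT_theta0 : frakc3DT theta0 = frakc3D := by
  rw [frakc3DT_eq_add, frakc3D_eq_frakc3r_add, frakc3rT_theta0, identResidualDT_theta0]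

/-- **The "theoretical interpretation" as an exact identity at every `θ`** (`k₁ ≠ 0`):
`identResidualᴰ(θ) = π b*(θ) Σ_j (3,6,3)_j (ῑ₃(e_{3j} − A₃ⱼ) + ῑ₄(e_{2j} − A₂ⱼ))(θ)` — with
`e3T_sub_A3T`, `e2T_sub_A2T` the brackets are the slivers `(1/ν₃)∫₀^{L₆}𝔣𝔣_{j,3}`, `(1/ν₂)∫₀^{L₇}𝔣𝔣_{j,2}`
(θ-generic `Section18EpsilonIdentity.identResidualD_eq_boundary`). [cite: Zhang2022LandauSiegel, §18 before (18.2)] -/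
theorem identResidualDT_eq_boundary (θ : Theta) (hk : θ.k1 ≠ 0) :
    identResidualDT θ = (π : ℂ) * bstarT θ *
      (3 * (conj θ.iota3 * (e3T θ 1 - A3T θ 1) + conj θ.iota4 * (e2T θ 1 - A2T θ 1))
        + 6 * (conj θ.iota3 * (e3T θ 2 - A3T θ 2) + conj θ.iota4 * (e2T θ 2 - A2T θ 2))
        + 3 * (conj θ.iota3 * (e3T θ 3 - A3T θ 3) + conj θ.iota4 * (e2T θ 3 - A2T θ 3))) := by
  unfold identResidualDT frakeppDT e1starT
  rw [e1ppDT_eq_neg_bstarT θ hk, e1ppDT_eq_neg_bstarT θ hk, e1ppDT_eq_neg_bstarT θ hk,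
    estar1T_eq, estar1T_eq, estar1T_eq]
  push_cast
  linear_combination (-(π : ℂ) * bstarT θ *
      (3 * (conj θ.iota3 * e3T θ 1 + conj θ.iota4 * e2T θ 1) * 1
        + 3 * (conj θ.iota3 * e3T θ 2 + conj θ.iota4 * e2T θ 2) * 2
        + (conj θ.iota3 * e3T θ 3 + conj θ.iota4 * e2T θ 3) * 3)) * Complex.I_sq

/-- The same with the slivers written out: `identResidualᴰ(θ) = π b*(θ) Σ_j (3,6,3)_j
(ῑ₃ (1/ν₃)∫₀^{L₆}𝔣𝔣_{j,3} + ῑ₄ (1/ν₂)∫₀^{L₇}𝔣𝔣_{j,2})` (`k₁, k₂, k₃, ν₂, ν₃ ≠ 0`).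
[cite: Zhang2022LandauSiegel, §18 before (18.2)] -/
theorem identResidualDT_eq_slivers (θ : Theta) (hk1 : θ.k1 ≠ 0) (hk2 : θ.k2 ≠ 0) (hk3 : θ.k3 ≠ 0)
    (hν2 : θ.nu2 ≠ 0) (hν3 : θ.nu3 ≠ 0) :
    identResidualDT θ = (π : ℂ) * bstarT θ *
      (3 * (conj θ.iota3 * ((∫ z in (0:ℝ)..θ.L6, ffT θ.k3 1 z) / (θ.nu3 : ℂ))
            + conj θ.iota4 * ((∫ z in (0:ℝ)..θ.L7, ffT θ.k2 1 z) / (θ.nu2 : ℂ)))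
        + 6 * (conj θ.iota3 * ((∫ z in (0:ℝ)..θ.L6, ffT θ.k3 2 z) / (θ.nu3 : ℂ))
            + conj θ.iota4 * ((∫ z in (0:ℝ)..θ.L7, ffT θ.k2 2 z) / (θ.nu2 : ℂ)))
        + 3 * (conj θ.iota3 * ((∫ z in (0:ℝ)..θ.L6, ffT θ.k3 3 z) / (θ.nu3 : ℂ))
            + conj θ.iota4 * ((∫ z in (0:ℝ)..θ.L7, ffT θ.k2 3 z) / (θ.nu2 : ℂ)))) := by
  rw [identResidualDT_eq_boundary θ hk1]
  simp only [e3T_sub_A3T θ hν3 hk3, e2T_sub_A2T θ hν2 hk2]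

end Repair

end Literature.NumberTheory.LFunctions.Zhang2022
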